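import Mathlib
import HarnessLib
import Summits.ABC.ABC.Theses.TwistAmplification
import Summits.ABC.ABC.Theorems.TwistAmplificationSomeWindowSavingInertBox
import Literature.NumberTheory.EllipticCurves.RealPeriod
import Literature.NumberTheory.EllipticCurves.AnalyticRank
import Literature.NumberTheory.EllipticCurves.QuadraticTwist
import Literature.NumberTheory.DiophantineGeometry.FaltingsHeight
import Literature.NumberTheory.DiophantineGeometry.LocalReduction
import Literature.NumberTheory.DiophantineGeometry.Conductor

/-!
# Sketch — crux `SomeWindowSaving` (stmt-ABC-1976), ideator 5, round 2

First-lemma signatures for the two round-2 crux idea cards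

* `Ideas/period-quantisation-rank-zero-twist.md`  (namespace `PeriodQuantisation`)
* `Ideas/solvable-semistable-base-change.md`     (namespace `SolvableSemistabilisation`)

Both lines enter the crux ONLY through the landed calibration
`Summit.ABC.ABC.Theorems.someWindowSaving_of_cofiniteWeakGenSzpiro` (p76658): every statement
below implies `CofiniteWeakGenSzpiro` (written out literally, identical to the hypothesis of that
theorem), and `SomeWindowSaving` follows with the witness `κ := K'+1, σ := K'+2, δ := 0`
(`K' = max K 3 ≥ 7` in effect, by Masser — cf. `Disproof.lean` Remark (i)); so nothing here touches
the refuted strengthenings `not_windowSaving_below_third / _below_law / _law'` (all about `κ < 4`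
or `σ ≤ 6`).  Statements are over existing declarations only; `sorry` marks what is NOT proved.
-/

noncomputable section

open WeierstrassCurve IsDedekindDomain NumberField MeasureTheory
open Summit.ABC.ABC.Theses.TwistAmplification

namespace Summit.ABC.ABC.Cruxes.SomeWindowSaving.SketchIdeator5

/-! ## Common vocabulary -/

/-- Conductor `N` of the generic fibre of an integral model, as a real number. -/
abbrev condR (W₀ : WeierstrassCurve ℤ) : ℝ := (((W₀.baseChange ℚ).conductorNorm ℤ : ℕ) : ℝ)

/-- `M⁺ = max(|Δ|, |c₄|³)` of an integral model, as a real number. -/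
abbrev maxInvR (W₀ : WeierstrassCurve ℤ) : ℝ := ((max |W₀.Δ| (|W₀.c₄| ^ 3) : ℤ) : ℝ)

/-- `W₀` is a global minimal integral model of an elliptic curve over `ℚ`. -/
def IsMinimalModel (W₀ : WeierstrassCurve ℤ) : Prop :=
  (W₀.baseChange ℚ).IsElliptic ∧ ∀ v : HeightOneSpectrum ℤ, (W₀.baseChange ℚ).IsMinimalAt v

/-- Cofinite weak generalized Szpiro — LITERALLY the hypothesis of the landed
`someWindowSaving_of_cofiniteWeakGenSzpiro` (and `Disproof.CofiniteWeakGenSzpiro`). -/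
def CofiniteWeakGenSzpiro : Prop :=
  ∃ K N₀ : ℝ, ∀ W₀ : WeierstrassCurve ℤ, (W₀.baseChange ℚ).IsElliptic →
    (∀ v : HeightOneSpectrum ℤ, (W₀.baseChange ℚ).IsMinimalAt v) → W₀.c₄ ≠ 0 → W₀.c₆ ≠ 0 →
      N₀ ≤ (((W₀.baseChange ℚ).conductorNorm ℤ : ℕ) : ℝ) →
        ((max |W₀.Δ| (|W₀.c₄| ^ 3) : ℤ) : ℝ) ≤ (((W₀.baseChange ℚ).conductorNorm ℤ : ℕ) : ℝ) ^ K

/-- Sanity link (kernel-checked): everything below reaches the crux through this. -/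
theorem someWindowSaving_of_cofinite (h : CofiniteWeakGenSzpiro) : SomeWindowSaving :=
  Summit.ABC.ABC.Theorems.someWindowSaving_of_cofiniteWeakGenSzpiro h

/-! ## Card A — period quantisation through one analytic-rank-zero twist

Lever: the real period `Ω(E)` of a minimal model is `≍ (M⁺)^{-1/12}` up to a logarithm
(elementary), and for a positive fundamental discriminant `D` prime to `6N` Birch's modular-symbol
formula quantises `L(E_D,1)·√D` in units of `Ω(E)/m_E` with `m_E ≤ N^{O(1)}`; a twist with
`L(E_D,1) ≥ N^{-B}`, `D ≤ N^A` exists by the first moment.  Hence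
`Ω(E) = m·L(E_D,1)√D / a ≥ N^{-B}/(C N^K)` as soon as the INTEGER `a = a(E,D)` (the algebraic
part; `= m·#Ш(E_D)·∏c_p/#E_D(ℚ)²_tors` by BSD) is `≤ C N^K` — the open core `PolyAlgebraicPart`. -/
namespace PeriodQuantisation

/-- The real period `Ω(W₀) = ∫_{E(ℝ)} |ω|` of the integral model viewed over `ℝ`
(`WeierstrassCurve.realPeriod`, Literature `RealPeriod.lean`). -/
def realPeriodZ (W₀ : WeierstrassCurve ℤ) : ℝ := (W₀.baseChange ℝ).realPeriod

/-- The central value `L(W,1)` of a Weierstrass curve over `ℚ` (real part of the entire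
continuation at `1`; a theorem over `ℚ` that it exists, `hasEntireLFunction_rat`). -/
def centralValue (W : WeierstrassCurve ℚ) : ℝ := (W.entireLFunction 1).re

/-- The quadratic twist `E_D` of the generic fibre, as a curve over `ℚ`. -/
def twistQ (W₀ : WeierstrassCurve ℤ) (D : ℤ) : WeierstrassCurve ℚ :=
  (W₀.baseChange ℚ).quadraticTwist (D : ℚ)

/-- `D` is an admissible twisting parameter for `W₀`: a positive squarefree `D ≡ 1 (mod 4)`
prime to `6N` (so `E_D` has conductor `N D²`, `Δ ↦ D⁶Δ`, `c₄ ↦ D²c₄`: stmt-ABC-1977, PROVED). -/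
def Admissible (W₀ : WeierstrassCurve ℤ) (D : ℤ) : Prop :=
  0 < D ∧ Squarefree D ∧ D ≡ 1 [ZMOD 4] ∧
    IsCoprime D (6 * ((W₀.baseChange ℚ).conductorNorm ℤ : ℤ))

/-- **A0 (calibration, elementary real analysis; provable now, size M/L).**  For every integral
model with `Δ ≠ 0`: `Ω(W₀) ≤ C₀ · (M⁺)^{-1/12} · log(2 + M⁺)`.  (Scaling `Ω(tΛ) = tΩ(Λ)`,
`M⁺ ↦ t^{-12}M⁺` — `realPeriod_smul_holds` is PROVED — plus continuity/compactness of the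
scale-invariant `Ω·(M⁺)^{1/12}` in `j ∈ ℝ ∪ {∞}` for the two real forms; the `log` is the split
nodal degeneration `|j| → ∞`, `Δ > 0`.)  The reverse inequality `c₀ (M⁺)^{-1/12} ≤ Ω` also holds,
so `PeriodLowerBound ↔ CofiniteWeakGenSzpiro` is an honest calibration target for the disprover. -/
def RealPeriodUpperBound : Prop :=
  ∃ C₀ : ℝ, ∀ W₀ : WeierstrassCurve ℤ, W₀.Δ ≠ 0 →
    realPeriodZ W₀ ≤ C₀ * maxInvR W₀ ^ (-(1 : ℝ) / 12) * Real.log (2 + maxInvR W₀)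

/-- **A1 `PeriodLowerBound`** — the period face of the crux: the real period of a minimal model is
at least a negative power of the conductor. Equivalent to `CofiniteWeakGenSzpiro` given A0 and its
converse. -/
def PeriodLowerBound : Prop :=
  ∃ K C : ℝ, 0 < C ∧ ∀ W₀ : WeierstrassCurve ℤ, IsMinimalModel W₀ →
    C * condR W₀ ^ (-K) ≤ realPeriodZ W₀

/-- **A2 (fact-shaped; in print as a first-moment theorem + convexity: Murty–Murty 1991,
Iwaniec 1990, Bump–Friedberg–Hoffstein 1990, with the constant `≫ L(Sym²E,2)`-type bounded below
by Hoffstein–Lockhart 1994).**  Every `E/ℚ` has an admissible twist `D ≤ N^A` whose central value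
is not smaller than `C N^{-B}` (in particular `E_D` has analytic rank `0`). To be vendored as a
Literature named fact once read on the page. -/
def SmallNonvanishingTwist : Prop :=
  ∃ A B C : ℝ, 0 < C ∧ ∀ W₀ : WeierstrassCurve ℤ, IsMinimalModel W₀ →
    ∃ D : ℤ, Admissible W₀ D ∧ (D : ℝ) ≤ condR W₀ ^ A ∧
      C * condR W₀ ^ (-B) ≤ centralValue (twistQ W₀ D)

/-- **A3 (fact-shaped; Birch–Manin modular symbols + Manin–Drinfeld; integrality with explicit
denominators: Wiersema–Wuthrich 2022).**  For admissible `D > 0`,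
`m · L(E_D,1) · √D = a · Ω(E)` with integers `a` and `0 < m ≤ C N^A`
(`m` absorbs the Manin constant, `#E(ℚ)[2]`-type denominators and the cuspidal torsion). -/
def TwistedValueQuantisation : Prop :=
  ∃ A C : ℝ, ∀ W₀ : WeierstrassCurve ℤ, IsMinimalModel W₀ → ∀ D : ℤ, Admissible W₀ D →
    ∃ (m : ℕ) (a : ℤ), 0 < m ∧ (m : ℝ) ≤ C * condR W₀ ^ A ∧
      (m : ℝ) * centralValue (twistQ W₀ D) * Real.sqrt D = a * realPeriodZ W₀

/-- **K1 `PolyAlgebraicPart` — THE OPEN CORE (crux-sized: equivalent to the crux given A0–A3).**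
Some small admissible twist with a not-too-small central value has a polynomially bounded
algebraic part: the integer `a` in `m·L(E_D,1)√D = a·Ω(E)` is `≤ C N^K`.  By the BSD formula in
analytic rank `0` (Kato, Skinner–Urban, …: known `p`-part for many `p`) `a = m·#Ш(E_D)∏c_p(E_D)/
#E_D(ℚ)²_tors`; `∏ c_p ≤ 4^{ω(N)}∏ v_p(Δ) ≤ N^{11/2+ε}` (Pasten), `#tors ≤ 16`, so K1 is a
POLYNOMIAL BOUND FOR `#Ш` OF ONE SMALL RANK-ZERO TWIST (Goldfeld–Szpiro 1995 ⟸ direction). -/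
def PolyAlgebraicPart : Prop :=
  ∃ A B K C : ℝ, 0 < C ∧ ∀ W₀ : WeierstrassCurve ℤ, IsMinimalModel W₀ →
    ∃ D : ℤ, Admissible W₀ D ∧ (D : ℝ) ≤ condR W₀ ^ A ∧
      condR W₀ ^ (-B) ≤ centralValue (twistQ W₀ D) ∧
      ∃ (m : ℕ) (a : ℤ), 0 < m ∧
        (m : ℝ) * centralValue (twistQ W₀ D) * Real.sqrt D = a * realPeriodZ W₀ ∧
        (|a| : ℝ) ≤ C * condR W₀ ^ K

/-- The real period of any real model is `≥ 0` (integral of a non-negative function; junk `0`). -/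
theorem realPeriodZ_nonneg (W₀ : WeierstrassCurve ℤ) : 0 ≤ realPeriodZ W₀ := by
  unfold realPeriodZ WeierstrassCurve.realPeriod
  refine mul_nonneg (by norm_num) (setIntegral_nonneg (W₀.baseChange ℝ).measurableSet_twoTorsionSet ?_)
  intro x _
  exact inv_nonneg.mpr (Real.sqrt_nonneg _)

/-- The conductor of an elliptic generic fibre is `≥ 1` as a real number. -/
theorem one_le_condR (W₀ : WeierstrassCurve ℤ) (hE : (W₀.baseChange ℚ).IsElliptic) :
    (1 : ℝ) ≤ condR W₀ := by
  haveI := hE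
  have h : 0 < (W₀.baseChange ℚ).conductorNorm ℤ :=
    WeierstrassCurve.conductorNorm_pos_holds (W₀.baseChange ℚ)
  unfold condR
  exact_mod_cast h

/-- **FIRST LEMMA of card A (KERNEL-CHECKED here): `PolyAlgebraicPart → PeriodLowerBound`.**
Pure real algebra: `Ω = m L √D / a` with `m ≥ 1`, `L ≥ N^{-B}`, `√D ≥ 1`, `0 < a ≤ C N^K`
(positivity of `a` from `Ω ≥ 0` and `m L √D > 0`), hence `Ω ≥ C⁻¹ N^{-(B+K)}`. -/
theorem periodLowerBound_of_polyAlgebraicPart (h : PolyAlgebraicPart) : PeriodLowerBound := by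
  obtain ⟨A, B, K, C, hC, h⟩ := h
  refine ⟨B + K, C⁻¹, inv_pos.mpr hC, fun W₀ hW₀ => ?_⟩
  obtain ⟨D, ⟨hD0, -, -, -⟩, -, hL, m, a, hm, heq, ha⟩ := h W₀ hW₀
  have hN : (1 : ℝ) ≤ condR W₀ := one_le_condR W₀ hW₀.1
  have hNpos : 0 < condR W₀ := by linarith
  set L : ℝ := centralValue (twistQ W₀ D) with hLdef
  set Ω : ℝ := realPeriodZ W₀ with hΩdef
  have hLpos : 0 < L := lt_of_lt_of_le (Real.rpow_pos_of_pos hNpos _) hL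
  have hm1 : (1 : ℝ) ≤ m := by exact_mod_cast hm
  have hD1 : (1 : ℝ) ≤ Real.sqrt D := by
    rw [show (1 : ℝ) = Real.sqrt 1 by simp]
    exact Real.sqrt_le_sqrt (by exact_mod_cast hD0)
  have hlhs : 0 < (m : ℝ) * L * Real.sqrt D := by positivity
  have hΩ0 : 0 ≤ Ω := realPeriodZ_nonneg W₀
  -- `a > 0`: from `a Ω = m L √D > 0` and `Ω ≥ 0`.
  have hapos : (0 : ℝ) < a := by
    rw [heq] at hlhs
    rcases lt_trichotomy (a : ℝ) 0 with ha0 | ha0 | ha0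
    · nlinarith
    · rw [ha0, zero_mul] at hlhs; exact absurd hlhs (lt_irrefl _)
    · exact ha0
  have hΩpos : 0 < Ω := by
    rcases hΩ0.lt_or_eq with h' | h'
    · exact h'
    · rw [heq, ← h', mul_zero] at hlhs; exact absurd hlhs (lt_irrefl _)
  have haC : (a : ℝ) ≤ C * condR W₀ ^ K := le_trans (le_abs_self _) ha
  -- lower bound: Ω = m L √D / a ≥ (1 · N^{-B} · 1) / (C N^K)
  have hD0' : 0 ≤ Real.sqrt D := Real.sqrt_nonneg _
  have hmD : 1 ≤ (m : ℝ) * Real.sqrt D := by nlinarith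
  have h1 : condR W₀ ^ (-B) ≤ (m : ℝ) * L * Real.sqrt D := by
    have : L ≤ (m : ℝ) * L * Real.sqrt D := by nlinarith
    exact le_trans hL this
  have h2 : condR W₀ ^ (-B) ≤ (a : ℝ) * Ω := by rw [← heq]; exact h1
  have h3 : condR W₀ ^ (-B) ≤ C * condR W₀ ^ K * Ω :=
    le_trans h2 (mul_le_mul_of_nonneg_right haC hΩ0)
  have hCK : 0 < C * condR W₀ ^ K := mul_pos hC (Real.rpow_pos_of_pos hNpos _)
  have h4 : condR W₀ ^ (-B) / (C * condR W₀ ^ K) ≤ Ω := by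
    rw [div_le_iff₀ hCK]; linarith [mul_comm (C * condR W₀ ^ K) Ω]
  calc C⁻¹ * condR W₀ ^ (-(B + K)) = condR W₀ ^ (-B) / (C * condR W₀ ^ K) := by
        rw [neg_add, Real.rpow_add hNpos, Real.rpow_neg hNpos.le K, div_eq_mul_inv, mul_inv]
        ring
    _ ≤ Ω := h4

/-- **A2 ∧ A3 ∧ (polynomial bound for the algebraic part of EVERY admissible small twist)
→ K1.**  Recorded to show how the fact-shaped inputs feed the core; the universally quantified
bound `UniformAlgebraicPart` is the Goldfeld–Szpiro-type statement "Ш(E_D)·Tam ≤ poly(N D²) for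
all rank-zero admissible twists". -/
def UniformAlgebraicPart : Prop :=
  ∃ K C : ℝ, 0 < C ∧ ∀ W₀ : WeierstrassCurve ℤ, IsMinimalModel W₀ → ∀ D : ℤ, Admissible W₀ D →
    ∀ (m : ℕ) (a : ℤ), 0 < m →
      (m : ℝ) * centralValue (twistQ W₀ D) * Real.sqrt D = a * realPeriodZ W₀ →
        (|a| : ℝ) ≤ C * (condR W₀ * (D : ℝ) ^ 2) ^ K

theorem polyAlgebraicPart_of_uniform :
    SmallNonvanishingTwist → TwistedValueQuantisation → UniformAlgebraicPart →
      PolyAlgebraicPart := by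
  sorry

/-- **A0 ∧ A1 → CofiniteWeakGenSzpiro** (elementary: `C N^{-K} ≤ Ω ≤ C₀ (M⁺)^{-1/12} log(2+M⁺)`
forces `M⁺ ≤ N^{12K+1}` for `N` large). -/
theorem cofinite_of_periodLowerBound :
    RealPeriodUpperBound → PeriodLowerBound → CofiniteWeakGenSzpiro := by
  sorry

/-- The whole card-A line, concluding the crux BY NAME (modulo the two `sorry`s above, whose
content is A0 (real analysis) and bookkeeping). -/
theorem someWindowSaving_of_cardA (h₀ : RealPeriodUpperBound) (h : PolyAlgebraicPart) :
    SomeWindowSaving :=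
  someWindowSaving_of_cofinite (cofinite_of_periodLowerBound h₀ (periodLowerBound_of_polyAlgebraicPart h))

end PeriodQuantisation

/-! ## Card B — solvable (totally real) semistabilisation

Lever: base change to a totally real field `F` of bounded degree over which `E` is semistable.
The stable Faltings height is invariant, `12 h(E/ℚ) ≤ 12 h_F(E) + 5 log N + O(1)`,
`log M⁺ ≤ 12 h(E/ℚ) + 6 log log M⁺ + O(1)` (Silverman 1986, proved in tree), the conductor over
`F` has norm `≤ rad(N)^{[F:ℚ]}` (semistable!) and `log|d_F| ≤ A log N + B`: so ONE statement —
weak generalized Szpiro for SEMISTABLE curves over totally real fields of degree `≤ ν`, polynomial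
in `N(𝔣)·|d_F|` — gives the crux with NO additive / Hall residue left over. -/
namespace SolvableSemistabilisation

/-- **B1 `WGSOverTotallyReal ν` — THE OPEN CORE.**  Faltings-height form of weak generalized
Szpiro for semistable elliptic curves over totally real number fields of degree `≤ ν`, with
constants depending on `ν` only and polynomial (here: linear in `log`) dependence on the
conductor norm and the field discriminant.  (`faltingsHeight` = `h(E/F)` of the tree, which is the
stable height since `E/F` is semistable; CM curves are harmless at bounded degree: `h(ℚ(j)) ≤ ν`
bounds the CM discriminant — so the barrier `UniformABCImpliesNoSiegelZeros`, which needs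
`[F:ℚ] → ∞`, is not engaged.) -/
def WGSOverTotallyReal (ν : ℕ) : Prop :=
  ∃ K C : ℝ, ∀ (F : Type) [Field F] [NumberField F], IsTotallyReal F →
    Module.finrank ℚ F ≤ ν → ∀ (W : WeierstrassCurve F) [W.IsElliptic], W.IsSemistable (𝓞 F) →
      12 * (Module.finrank ℚ F : ℝ) * W.faltingsHeight ≤
        K * (Real.log (W.conductorNorm (𝓞 F)) + Real.log ((NumberField.discr F).natAbs : ℝ)) + C

/-- **B2 `SemistabilisingField ν` (KNOWN mathematics, formalisation XL: Krasner's lemma + weak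
approximation with real-rootedness + "semistability is inherited by extensions"; `ν` an absolute
constant, e.g. `48!`).**  Every `E/ℚ` becomes semistable over some totally real `F` of degree
`≤ ν` with `log|d_F| ≤ A log N + B`, and then `N(𝔣(E/F)) ≤ N^{[F:ℚ]}`. -/
def SemistabilisingField (ν : ℕ) : Prop :=
  ∃ A B : ℝ, ∀ W₀ : WeierstrassCurve ℤ, (W₀.baseChange ℚ).IsElliptic →
    ∃ (F : Type) (_ : Field F) (_ : NumberField F), IsTotallyReal F ∧
      Module.finrank ℚ F ≤ ν ∧
      ((W₀.baseChange ℚ).baseChange F).IsSemistable (𝓞 F) ∧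
      Real.log ((NumberField.discr F).natAbs : ℝ) ≤ A * Real.log (condR W₀) + B ∧
      ((((W₀.baseChange ℚ).baseChange F).conductorNorm (𝓞 F) : ℕ) : ℝ) ≤
        condR W₀ ^ (Module.finrank ℚ F : ℝ)

/-- **B3 stable-height transfer (provable now modulo tree API on `faltingsHeight` /
`stableFaltingsHeight`: base-change invariance of `h_F`, `h(E/F) = h_F(E)` for semistable `E/F`,
`12 h(E/ℚ) − 12 h_F(E) = log Υ ≤ 5 log N + c` (unstable discriminant at additive primes),
`log M⁺ ≤ 12 h(E/ℚ) + 6 log⁺log⁺|j| + c` (Silverman 1986 covolume inequality, PROVED in tree)).**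
FIRST LEMMA of card B. -/
theorem cofinite_of_wgsOverTotallyReal (ν : ℕ) :
    SemistabilisingField ν → WGSOverTotallyReal ν → CofiniteWeakGenSzpiro := by
  sorry

/-- The whole card-B line, concluding the crux BY NAME (modulo B3). -/
theorem someWindowSaving_of_cardB (ν : ℕ) (hF : SemistabilisingField ν)
    (h : WGSOverTotallyReal ν) : SomeWindowSaving :=
  someWindowSaving_of_cofinite (cofinite_of_wgsOverTotallyReal ν hF h)

end SolvableSemistabilisation

end Summit.ABC.ABC.Cruxes.SomeWindowSaving.SketchIdeator5

end
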